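import Literature.Geometry.Lorentzian.PositiveMassRigidity
import HarnessLib

/-!
# Conformal data `φ⁴ h`

The conformal changes of metric of Schoen–Yau, Comm. Math. Phys. 65 (1979) — §2 Step 1 (p. 49:
`d̃s² = φ⁴ ds²` with the superharmonic factor (2.2)), Lemma 3.3 and Cor. 3.1 (p. 71–72: `φ⁴ ds²`
scalar flat), and the Ricci variation (p. 73: `φ_t⁴ ds²_t`) — all replace the metric `h` of the
data by `φ⁴ h` for a smooth positive function `φ` on the manifold. This file provides that
construction once, as a real definition, for the facts of the positive-mass DAG
(`PositiveMassRigidity.lean`, `PositiveMassSchoenYau.lean`) which conclude with such data: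

* `InitialDataSet.conformal D φ hφ hpos` — **the conformal data `(φ⁴ h, k)`** of an initial data
  set `D = (h, k)` (any model with corners on a finite-dimensional space): the metric
  `x ↦ φ(x)⁴ h_x` is again a Mathlib `ContMDiffRiemannianMetric` (symmetric, positive definite,
  von Neumann bounded unit balls by finite dimension, smooth by `ContMDiff.smul_section`); `k` is
  kept. API: `conformal_h_inner`, `metric_conformal_val`, `conformal_k` (all `rfl`).
* `AFEnd.hCoeff_conformal` — for an end `e` of a `3`-manifold, **the conformal metric read in the
  chart**: `hCoeff e (φ⁴ h) y = φ(Φ y)⁴ • hCoeff e h y` for `R < ‖y‖` (`Φ = e.dataChart`), proved.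

The expansion (1.1) of `φ⁴ h` when `φ = 1 - M/4r` far out, and Step 1 of the proof of Thm. 1
assembled from its two printed ingredients (the conformal transformation law
`R(φ⁴ g) = φ⁻⁵(Rφ - 8Δφ)` and the superharmonic factor (2.1)–(2.3)), are proved in
`PositiveMassConformalProofs.lean`.

## Design

* `D.conformal` keeps `k` unchanged (the conformal arguments of Schoen–Yau 1979 concern the
  metric only; any choice would do) and asks for a globally positive smooth `φ`, as in all three
  uses in the source.
* The Levi-Civita instance of the conformal metric is not bundled: every smooth metric has one
  (`PseudoRiemannianMetric.hasLeviCivita`), to be introduced with `haveI` where curvature of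
  `φ⁴ h` is discussed.

## References

* R. Schoen, S.-T. Yau, *On the proof of the positive mass conjecture in general relativity*,
  Comm. Math. Phys. 65 (1979) 45–76, §2 Step 1 (p. 49), Lemma 3.3 (p. 71), p. 73.
-/

noncomputable section

open Bundle Set Manifold TopologicalSpace Filter Asymptotics Module
open scoped ContDiff Topology Manifold

namespace Literature.Geometry.Lorentzian

/-! ### Conformal data -/

section Conformal

variable {E : Type*} [NormedAddCommGroup E] [NormedSpace ℝ E] [FiniteDimensional ℝ E]
  {H : Type*} [TopologicalSpace H] {I : ModelWithCorners ℝ E H}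
  {X : Type*} [TopologicalSpace X] [ChartedSpace H X] [IsManifold I ∞ X]

namespace InitialDataSet

/-- **Conformal data.** For an initial data set `D = (h, k)` and a smooth positive function `φ`
on `X`, the data `(φ⁴ h, k)`: the metric `x ↦ φ(x)⁴ h_x` is symmetric, positive definite,
with von Neumann bounded unit balls (finite dimension), and smooth as a section of the bundle of
bilinear forms (`ContMDiff.smul_section`); `k` is kept. This is the conformal change
`d̃s² = φ⁴ ds²` of Schoen–Yau, Comm. Math. Phys. 65 (1979), §2 Step 1 (p. 49) and Lemma 3.3
(p. 71). [cite: SchoenYauPMT1979, §2 Step 1 (p. 49)] -/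
def conformal (D : InitialDataSet I X) (φ : X → ℝ) (hφ : ContMDiff I 𝓘(ℝ) ∞ φ)
    (hpos : ∀ x, 0 < φ x) : InitialDataSet I X where
  h :=
    { inner := fun x ↦ (φ x ^ 4) • D.h.inner x
      symm := fun x v w ↦ by
        change φ x ^ 4 * D.h.inner x v w = φ x ^ 4 * D.h.inner x w v
        rw [D.h.symm x v w]
      pos := fun x v hv ↦ by
        change 0 < φ x ^ 4 * D.h.inner x v v
        exact mul_pos (pow_pos (hpos x) 4) (D.h.pos x v hv)
      isVonNBounded := fun x ↦ by
        refine PseudoRiemannianMetric.IsSpacelikeImmersion.isVonNBounded_setOf_lt_one_of_pos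
          (V := E) ((φ x ^ 4) • D.h.inner x) fun v hv ↦ ?_
        change 0 < φ x ^ 4 * D.h.inner x v v
        exact mul_pos (pow_pos (hpos x) 4) (D.h.pos x v hv)
      contMDiff := by
        have h4 : ContMDiff I 𝓘(ℝ) ∞ (fun x ↦ φ x ^ 4) := (contDiff_id.pow 4).comp_contMDiff hφ
        exact h4.smul_section D.h.contMDiff }
  k := D.k
  k_symm := D.k_symm
  contMDiff_k := D.contMDiff_k

/-- The metric of the conformal data at `x` is `φ(x)⁴ h_x`. Schoen–Yau 1979, §2 Step 1.
[cite: SchoenYauPMT1979, §2 Step 1 (p. 49)] -/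
@[simp]
lemma conformal_h_inner (D : InitialDataSet I X) (φ : X → ℝ) (hφ : ContMDiff I 𝓘(ℝ) ∞ φ)
    (hpos : ∀ x, 0 < φ x) (x : X) :
    (D.conformal φ hφ hpos).h.inner x = (φ x ^ 4) • D.h.inner x := rfl

/-- The metric of the conformal data on vectors: `(φ⁴ h)_x (v, w) = φ(x)⁴ h_x(v, w)`.
Schoen–Yau 1979, §2 Step 1. [cite: SchoenYauPMT1979, §2 Step 1 (p. 49)] -/
@[simp]
lemma metric_conformal_val (D : InitialDataSet I X) (φ : X → ℝ) (hφ : ContMDiff I 𝓘(ℝ) ∞ φ)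
    (hpos : ∀ x, 0 < φ x) (x : X) (v w : TangentSpace I x) :
    (D.conformal φ hφ hpos).metric.val x v w = φ x ^ 4 * D.metric.val x v w := rfl

/-- The tensor `k` of the conformal data is that of `D`. [folklore] -/
@[simp]
lemma conformal_k (D : InitialDataSet I X) (φ : X → ℝ) (hφ : ContMDiff I 𝓘(ℝ) ∞ φ)
    (hpos : ∀ x, 0 < φ x) (x : X) : (D.conformal φ hφ hpos).k x = D.k x := rfl

end InitialDataSet

end Conformal

section End

variable {X : Type*} [TopologicalSpace X] [ChartedSpace E3 X] [IsManifold (𝓡 3) ∞ X]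

/-- **The conformal metric read in the chart of an end**: for `R < ‖y‖`,
`hCoeff e (φ⁴ h) y = φ(Φ y)⁴ • hCoeff e h y` (`Φ = e.dataChart`; both sides are pullbacks along
`Φ`, and the pullback of `φ⁴ h` is `(φ ∘ Φ)⁴` times the pullback of `h`). Schoen–Yau 1979, §2
Step 1 (p. 49: "on `N_k` we have `d̃s² = φ⁴ ds²`" in the asymptotic coordinates).
[cite: SchoenYauPMT1979, §2 Step 1 (p. 49)] -/
theorem AFEnd.hCoeff_conformal (e : AFEnd X) (D : InitialDataSet (𝓡 3) X) (φ : X → ℝ)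
    (hφ : ContMDiff (𝓡 3) 𝓘(ℝ) ∞ φ) (hpos : ∀ x, 0 < φ x) {y : E3} (hy : e.R < ‖y‖) :
    AFEnd.hCoeff e (D.conformal φ hφ hpos) y =
      (φ (e.dataChart ⟨y, hy⟩) ^ 4) • AFEnd.hCoeff e D y := by
  rw [AFEnd.hCoeff_of_lt _ hy, AFEnd.hCoeff_of_lt _ hy]
  ext v w
  change pullbackBilin _ _ _ v w =
    φ (e.dataChart ⟨y, hy⟩) ^ 4 * pullbackBilin (I := 𝓡 3) (I' := 𝓡 3) e.dataChart D.h.inner ⟨y, hy⟩ v w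
  rw [pullbackBilin_apply, pullbackBilin_apply]
  rfl

end End

end Literature.Geometry.Lorentzian

end
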